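import Literature.NumberTheory.GaloisRepresentations.AdmissibleTwist
import Literature.NumberTheory.GaloisRepresentations.PstWeilDeligneModelIndependence
import Literature.NumberTheory.GaloisRepresentations.PstWeilDeligneCyclotomicWeight
import Literature.NumberTheory.GaloisRepresentations.UnramifiedAdmissible
import Literature.NumberTheory.GaloisRepresentations.FramedRepTwist
import Literature.NumberTheory.PAdicHodge.FontaineDpst
import HarnessLib

/-!
# Tate twists of de Rham representations are de Rham, for every `p`-adic Hodge datum

Topic `NumberTheory/GaloisRepresentations`; theorems only (no definition, no named fact).  Let `F` be
a non-archimedean local field of residue characteristic `ℓ`, `𝔇 : PstWeilDeligneData F ℓ` a `p`-adic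
Hodge datum (accepted: a `ℚ_ℓ`-structure on `F`, a Fontaine-regular period-ring datum `𝔅`, a
`D_pst`-relation), `ρ : Γ_F →ₜ* GL_n(ℚ̄_ℓ)` and `ε : Γ_F →ₜ* ℚ̄_ℓˣ` a continuous character with
`ε(σ) = χ_ℓ(σ)^k` (`χ_ℓ` the `ℓ`-adic cyclotomic character of `F`, `k ∈ ℤ`; as in the accepted
`TateTwistFrobeniusProofs` the twisting character is quantified with this pointwise identity, not
introduced as a definition).

* `PstWeilDeligneData.IsDeRhamFramed.tateTwist` — **if `ρ` is de Rham for `𝔇` and the cyclotomic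
  character is de Rham for `𝔇` (e.g. clause (F2) `CyclotomicWeightNegOne` of `IsFontaineDatum`), then
  the Tate twist `ρ ⊗ ε = ρ.twist ε` is de Rham for `𝔇`**, for every `k ∈ ℤ`.  Proof: a period
  `s ∈ B` of `χ_ℓ` (`dim_F D(χ_ℓ) = 1`) is a unit of `B` (Fontaine regularity (iii)) and `s^k` is a
  period of `χ_ℓ^k`; on a finite model `rE` of `ρ` over `E ⊆ ℚ̄_ℓ`, `rE ⊗ ε_E` is a model of `ρ ⊗ ε`
  and multiplication by `s^k` injects `D(rE)` into `D(rE ⊗ ε_E)` (accepted `AdmissibleTwist`),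
  so Fontaine's inequality gives admissibility (Fontaine 1994, Exp. III Prop. 1.5.2, twist case).
* `IsFontaineDatum.isDeRhamFramed_tateTwist`, `fontainePstAdicCompletion_isDeRhamFramed_tateTwist` — the
  same for every datum with Fontaine's clauses, in particular the summit's PINNED datum under
  `FontaineDatumExists`: **Tate twists preserve the "de Rham above `ℓ`" clause of `Langlands`**.
* `PstWeilDeligneData.isDeRhamFramed_tateTwist_of_isLocallyUnramified` — unramified `⊗ χ_ℓ^k` is de
  Rham (the local shape at `v ∣ ℓ` of the `ℓ`-adic avatar of an algebraic Hecke character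
  `χ₀ ‖·‖^{-k}` with `χ₀` unramified at `v`).

Auxiliary, reusable: `PeriodRingData.exists_period_of_isAdmissible_scalar` (a scalar admissible
representation on a line has a nonzero period), `PeriodRingData.period_zpow`,
`restrictScalarsQl_twist_apply`, `FramedRep.baseChange_twist`, `HasQlModel.twist`,
`PstWeilDeligneData.exists_period_cyclotomic`.

## References
* [FontaineAsterisque223III] J.-M. Fontaine, *Représentations p-adiques semi-stables*,
  Astérisque 223 (1994), Exp. III §1.4–1.5 (Prop. 1.5.2).
* [SerreAbelianLadic1968] J.-P. Serre, *Abelian ℓ-adic representations* (1968), Ch. I §1.2.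
* [BuzzardGeeLMS2014] K. Buzzard, T. Gee, *The conjectural connections …* (2014), §2.2 (models
  over finite `E/ℚ_ℓ`).
-/

noncomputable section

open scoped TensorProduct MatrixGroups Matrix
open Field Literature.NumberTheory.Automorphic

namespace Literature.NumberTheory.GaloisRepresentations

/-! ### 0. Two more facts on periods (generic period-ring datum) -/

namespace PeriodRingData

-- Mathlib's own global value of `maxSynthPendingDepth` (see the note in `PAdicHodgeProofs`).
set_option maxSynthPendingDepth 3

universe u v v' w w'

variable {Γ : Type u} [Group Γ] [TopologicalSpace Γ] {P : Type v} {E : Type v'} [Field P]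
  [TopologicalSpace P] [Field E] [Algebra P E]
  {M : Type w'} [AddCommGroup M] [Module P M] [TopologicalSpace M]
  (𝔅 : PeriodRingData.{u, v, v', w} Γ P E)

/-- **A scalar admissible representation on a line has a nonzero period.**  If `Γ` acts on the
one-dimensional `M` through the scalar function `θ` (`ρ₀(σ) m = θ(σ) m`) and `ρ₀` is
`𝔅`-admissible, then some `s ∈ B`, `s ≠ 0`, has `θ(σ)·σ(s) = s` for all `σ` (read a nonzero
invariant of `B ⊗_P M = B ⊗ m₀` in the basis `1 ⊗ m₀`). [cite: FontaineAsterisque223III, Exp. III §1.5] -/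
theorem exists_period_of_isAdmissible_scalar [FiniteDimensional P M] (ρ₀ : ContinuousRep Γ P M)
    (hM : Module.finrank P M = 1) (θ : Γ → P) (h : ∀ (σ : Γ) (m : M), ρ₀ σ m = θ σ • m)
    (h0 : 𝔅.IsAdmissible ρ₀) :
    ∃ s : 𝔅.B, s ≠ 0 ∧ ∀ σ : Γ, algebraMap P 𝔅.B (θ σ) * σ • s = s := by
  classical
  let bM := Module.finBasisOfFinrankEq P M hM
  let β := Algebra.TensorProduct.basis 𝔅.B bM
  have hD : Module.finrank E (𝔅.D ρ₀) = 1 := h0.trans hM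
  have hne : 𝔅.D ρ₀ ≠ ⊥ := fun hbot => by
    rw [hbot, finrank_bot] at hD
    exact zero_ne_one hD
  obtain ⟨x, hx, hx0⟩ := Submodule.exists_mem_ne_zero_of_ne_bot hne
  have key : ∀ d : 𝔅.B, β.repr (d ⊗ₜ[P] bM 0) 0 = d := fun d => by
    rw [← Algebra.TensorProduct.basis_repr_symm_apply', map_smul, β.repr_self, Finsupp.smul_single,
      smul_eq_mul, mul_one, Finsupp.single_eq_same]
  have hxc : x = β.repr x 0 ⊗ₜ[P] bM 0 := by
    conv_lhs => rw [← β.sum_repr x]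
    rw [Fin.sum_univ_one, Algebra.TensorProduct.basis_repr_symm_apply']
  refine ⟨β.repr x 0, fun h0' => hx0 (by rw [hxc, h0', TensorProduct.zero_tmul]), fun σ => ?_⟩
  have hinv := (𝔅.mem_D_iff ρ₀ x).1 hx σ
  rw [hxc, tensorRep_apply_tmul, h σ, TensorProduct.tmul_smul, TensorProduct.smul_tmul'] at hinv
  have h2 := congrArg (fun y => β.repr y 0) hinv
  simp only [key] at h2
  rwa [Algebra.smul_def] at h2

omit [TopologicalSpace Γ] [TopologicalSpace P] in
/-- **Powers of a unit period**: if the unit `u` is a period of `θ`, then `u^k` is a period of `θ^k`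
for every `k ∈ ℤ`. [cite: FontaineAsterisque223III, Exp. III Prop. 1.5.2] -/
theorem period_zpow {θ : Γ → P} {u : 𝔅.Bˣ}
    (hu : ∀ σ : Γ, algebraMap P 𝔅.B (θ σ) * σ • (u : 𝔅.B) = u) (k : ℤ) :
    ∀ σ : Γ, algebraMap P 𝔅.B (θ σ ^ k) * σ • ((u ^ k : 𝔅.Bˣ) : 𝔅.B) = (u ^ k : 𝔅.Bˣ) := by
  -- natural powers
  have hnat : ∀ (m : ℕ) (σ : Γ),
      algebraMap P 𝔅.B (θ σ ^ m) * σ • ((u ^ m : 𝔅.Bˣ) : 𝔅.B) = (u ^ m : 𝔅.Bˣ) := by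
    intro m
    induction m with
    | zero => intro σ; simp [smul_one]
    | succ m ih =>
      intro σ
      rw [pow_succ, pow_succ, Units.val_mul]
      exact 𝔅.period_mul ih hu σ
  obtain ⟨m, rfl | rfl⟩ := k.eq_nat_or_neg
  · simpa only [zpow_natCast] using hnat m
  · -- negative powers: the inverse of the period `u ^ m` of `θ ^ m`
    intro σ
    obtain ⟨s', -, hs'1, hs'⟩ := 𝔅.exists_period_inv (Units.ne_zero (u ^ m)) (hnat m)
    have hs'eq : s' = ((u ^ m)⁻¹ : 𝔅.Bˣ) := by
      rw [← one_mul s', ← Units.inv_mul (u ^ m), mul_assoc, hs'1, mul_one]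
    rw [zpow_neg, zpow_natCast, zpow_neg, zpow_natCast, ← hs'eq]
    exact hs' σ

end PeriodRingData

/-! ### 1. Twists of framed representations: models and restriction of scalars -/

section Framed

variable {G : Type*} [Group G] [TopologicalSpace G] {ℓ : ℕ} [Fact ℓ.Prime] {n : ℕ}

/-- **Base change commutes with twisting**: `(rE ⊗ χ_E) ⊗_f B = (rE ⊗_f B) ⊗ f(χ_E)`, for any
character `χ_B` with `χ_B(g) = f(χ_E(g))`. [folklore] -/
theorem FramedRep.baseChange_twist {A B : Type*} [CommRing A] [TopologicalSpace A]
    [IsTopologicalRing A] [CommRing B] [TopologicalSpace B] [IsTopologicalRing B]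
    (f : A →+* B) (hf : Continuous f) (rE : FramedRep G A n) (χA : G →ₜ* Aˣ) (χB : G →ₜ* Bˣ)
    (hχ : ∀ g, (χB g : B) = f (χA g)) :
    (rE.twist χA).baseChange f hf = (rE.baseChange f hf).twist χB := by
  refine ContinuousMonoidHom.ext fun g => Units.ext ?_
  rw [FramedRep.coe_baseChange_apply, FramedRep.coe_twist_apply, FramedRep.coe_twist_apply,
    FramedRep.coe_baseChange_apply, hχ g]
  ext i j
  simp [Matrix.map_apply, Matrix.smul_apply]

/-- **A model of `ρ` twisted by a model of the character is a model of the twist**: if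
`ρ = P (rE ⊗_E ℚ̄_ℓ) P⁻¹` and `χ'(g) = χ_E(g)` in `ℚ̄_ℓ`, then `ρ ⊗ χ' = P ((rE ⊗ χ_E) ⊗_E ℚ̄_ℓ) P⁻¹`.
Deliberate dot-notation extension of the accepted `HasQlModel`. [cite: BuzzardGeeLMS2014, §2.2] -/
theorem _root_.Literature.NumberTheory.Automorphic.HasQlModel.twist {K : Type} [Field K]
    {ρ : FramedGaloisRep K (PadicAlgCl ℓ) n} {E : IntermediateField ℚ_[ℓ] (PadicAlgCl ℓ)}
    {rE : FramedGaloisRep K E n} (h : HasQlModel ρ E rE) (χE : absoluteGaloisGroup K →ₜ* Eˣ)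
    (χ' : absoluteGaloisGroup K →ₜ* (PadicAlgCl ℓ)ˣ)
    (hχ : ∀ g, (χ' g : PadicAlgCl ℓ) = algebraMap E (PadicAlgCl ℓ) (χE g)) :
    HasQlModel (ρ.twist χ') E (rE.twist χE) := by
  obtain ⟨P, hP⟩ := h
  refine ⟨P, ?_⟩
  rw [FramedRep.baseChange_twist _ _ rE χE χ' hχ]
  calc FramedRep.conj P ((FramedRep.baseChange (algebraMap E (PadicAlgCl ℓ)) continuous_subtype_val rE).twist χ')
      = (FramedRep.conj P (FramedRep.baseChange (algebraMap E (PadicAlgCl ℓ)) continuous_subtype_val rE)).twist χ' :=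
        FramedRep.conj_twist _ _ _
    _ = ρ.twist χ' := by rw [hP]

/-- **Restriction of scalars of a twisted model**: `(rE ⊗ χ_E)(σ) x = χ_E(σ) • rE(σ) x` on
`Fin n → E`, `ℚ_ℓ`-linearly. [folklore] -/
theorem restrictScalarsQl_twist_apply {K : Type} [Field K] (E : IntermediateField ℚ_[ℓ] (PadicAlgCl ℓ))
    (rE : FramedGaloisRep K E n) (χE : absoluteGaloisGroup K →ₜ* Eˣ) (σ : absoluteGaloisGroup K)
    (x : Fin n → E) :
    restrictScalarsQl E (rE.twist χE) σ x = (χE σ : E) • restrictScalarsQl E rE σ x := by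
  rw [restrictScalarsQl_apply_apply, restrictScalarsQl_apply_apply]
  change ((rE.twist χE σ : GL (Fin n) E) : Matrix (Fin n) (Fin n) E) *ᵥ x =
    (χE σ : E) • (((rE σ : GL (Fin n) E) : Matrix (Fin n) (Fin n) E) *ᵥ x)
  rw [FramedRep.coe_twist_apply, Matrix.smul_mulVec]

end Framed

/-! ### 2. A period of the cyclotomic character -/

section Local

-- Mathlib's own global value of `maxSynthPendingDepth` (see the note in `PAdicHodgeProofs`).
set_option maxSynthPendingDepth 3

variable {F : Type} [Field F] [ValuativeRel F] [TopologicalSpace F] [IsNonarchimedeanLocalField F]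
  {ℓ : ℕ} [Fact ℓ.Prime]

/-- **A `p`-adic Hodge datum for which the cyclotomic character is de Rham has a cyclotomic
period**: some `s ∈ B`, `s ≠ 0`, with `χ_ℓ(σ)·σ(s) = s` for all `σ ∈ Γ_F` (for Fontaine's `B_dR`:
`s = t⁻¹`).  Proof: the model of `χ_ℓ` over `ℚ_ℓ = ⊥ ⊆ ℚ̄_ℓ` is admissible by model independence
(accepted `isDeRhamFramed_iff_of_hasQlModel`), and a scalar admissible representation on a line has
a period. [cite: FontaineAsterisque223III, Exp. III §1.5 and Exp. II §1.5.5] -/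
theorem PstWeilDeligneData.exists_period_cyclotomic (𝔇 : PstWeilDeligneData F ℓ)
    (hcyc : 𝔇.IsDeRhamFramed (FramedGaloisRep.cyclotomicPadicAlgCl F ℓ)) :
    letI := 𝔇.algebra
    ∃ s : 𝔇.𝔅.B, s ≠ 0 ∧ ∀ σ : absoluteGaloisGroup F,
      algebraMap ℚ_[ℓ] 𝔇.𝔅.B (((GaloisRep.cyclotomicCharacter F ℓ σ : ℤ_[ℓ]ˣ) : ℤ_[ℓ]) : ℚ_[ℓ]) *
        σ • s = s := by
  letI := 𝔇.algebra
  set E₀ : IntermediateField ℚ_[ℓ] (PadicAlgCl ℓ) := ⊥ with hE₀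
  haveI : ContinuousSMul ℚ_[ℓ] E₀ := IntermediateField.continuousSMul_padicAlgCl E₀
  haveI : FiniteDimensional ℚ_[ℓ] E₀ := by rw [hE₀]; infer_instance
  -- the model over `ℚ_ℓ = ⊥`
  set f₀ : ℤ_[ℓ] →+* E₀ := (algebraMap ℚ_[ℓ] E₀).comp PadicInt.Coe.ringHom with hf₀
  have hf₀c : Continuous f₀ := (continuous_algebraMap ℚ_[ℓ] E₀).comp continuous_subtype_val
  set r₀ : FramedGaloisRep F E₀ 1 := FramedRep.baseChange f₀ hf₀c (FramedGaloisRep.cyclotomic F ℓ)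
    with hr₀
  have hentry : ∀ (σ : absoluteGaloisGroup F) (i j : Fin 1),
      ((r₀ σ : GL (Fin 1) E₀) : Matrix (Fin 1) (Fin 1) E₀) i j =
        algebraMap ℚ_[ℓ] E₀ (((GaloisRep.cyclotomicCharacter F ℓ σ : ℤ_[ℓ]ˣ) : ℤ_[ℓ]) : ℚ_[ℓ]) := by
    intro σ i j
    rw [hr₀, FramedRep.coe_baseChange_apply, Matrix.map_apply]
    simp [FramedGaloisRep.cyclotomic, hf₀]
  have hmodel : HasQlModel (FramedGaloisRep.cyclotomicPadicAlgCl F ℓ) E₀ r₀ := by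
    refine ⟨1, ContinuousMonoidHom.ext fun σ => Units.ext (Matrix.ext fun i j => ?_)⟩
    rw [FramedRep.conj_apply, one_mul, inv_one, mul_one, FramedRep.coe_baseChange_apply,
      Matrix.map_apply, hentry, FramedGaloisRep.cyclotomicPadicAlgCl_apply_coe]
    exact (IsScalarTower.algebraMap_apply ℚ_[ℓ] E₀ (PadicAlgCl ℓ) _).symm
  have hadm := (𝔇.isDeRhamFramed_iff_of_hasQlModel hmodel).1 hcyc
  -- the `ℚ_ℓ`-linear model acts by the scalar `χ_ℓ(σ)` on the line `Fin 1 → ⊥`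
  have hM : Module.finrank ℚ_[ℓ] (Fin 1 → E₀) = 1 := by
    rw [Module.finrank_pi_fintype, Finset.sum_const, Finset.card_univ, Fintype.card_fin, smul_eq_mul,
      one_mul, hE₀, IntermediateField.finrank_bot]
  refine 𝔇.𝔅.exists_period_of_isAdmissible_scalar (restrictScalarsQl E₀ r₀) hM
    (fun σ => (((GaloisRep.cyclotomicCharacter F ℓ σ : ℤ_[ℓ]ˣ) : ℤ_[ℓ]) : ℚ_[ℓ])) (fun σ x => ?_) hadm
  rw [restrictScalarsQl_apply_apply]
  change ((r₀ σ : GL (Fin 1) E₀) : Matrix (Fin 1) (Fin 1) E₀) *ᵥ x = _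
  funext i
  rw [Matrix.mulVec, dotProduct, Fin.sum_univ_one, hentry, Pi.smul_apply, Subsingleton.elim 0 i,
    Algebra.smul_def]

/-! ### 3. Tate twists of de Rham representations are de Rham -/

/-- **Tate twists of de Rham representations are de Rham** (every `p`-adic Hodge datum for which the
cyclotomic character is de Rham).  Let `𝔇 : PstWeilDeligneData F ℓ` with `χ_ℓ` de Rham for `𝔇`,
`ρ : Γ_F →ₜ* GL_n(ℚ̄_ℓ)` de Rham for `𝔇`, `k ∈ ℤ` and `ε : Γ_F →ₜ* ℚ̄_ℓˣ` with `ε(σ) = χ_ℓ(σ)^k`.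
Then `ρ ⊗ ε` (`ρ.twist ε`) is de Rham for `𝔇`.  Proof: a cyclotomic period `s` is a unit and `s^k`
is a period of `χ_ℓ^k`; on a finite model `rE` of `ρ` the twist `rE ⊗ ε_E` models `ρ ⊗ ε`, its
`ℚ_ℓ`-restriction is the scalar twist of that of `rE`, and admissibility transfers along
multiplication by `s^k` (accepted `isAdmissible_of_twist_period`).
[cite: FontaineAsterisque223III, Exp. III Prop. 1.5.2] [cite: SerreAbelianLadic1968, Ch. I §1.2] -/
theorem PstWeilDeligneData.IsDeRhamFramed.tateTwist {𝔇 : PstWeilDeligneData F ℓ} {n : ℕ}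
    {ρ : FramedRep (absoluteGaloisGroup F) (PadicAlgCl ℓ) n} (hρ : 𝔇.IsDeRhamFramed ρ)
    (hcyc : 𝔇.IsDeRhamFramed (FramedGaloisRep.cyclotomicPadicAlgCl F ℓ)) (k : ℤ)
    (ε : absoluteGaloisGroup F →ₜ* (PadicAlgCl ℓ)ˣ)
    (hε : ∀ σ, (ε σ : PadicAlgCl ℓ) =
      (algebraMap ℚ_[ℓ] (PadicAlgCl ℓ)
        ((GaloisRep.cyclotomicCharacter F ℓ σ : ℤ_[ℓ]ˣ) : ℤ_[ℓ])) ^ k) :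
    𝔇.IsDeRhamFramed (ρ.twist ε) := by
  letI := 𝔇.algebra
  -- the period of `χ_ℓ^k`
  obtain ⟨s, hs0, hs⟩ := 𝔇.exists_period_cyclotomic hcyc
  obtain ⟨u, rfl⟩ := 𝔇.𝔅.isUnit_of_period hs0 hs
  have hk := 𝔇.𝔅.period_zpow hs k
  -- a finite model of `ρ` and the twisted model
  obtain ⟨E, hE, rE, hmodel, hdR⟩ := hρ
  haveI : FiniteDimensional ℚ_[ℓ] E := hE
  haveI : ContinuousSMul ℚ_[ℓ] E := IntermediateField.continuousSMul_padicAlgCl E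
  set θ : absoluteGaloisGroup F → ℚ_[ℓ] := fun σ =>
    (((GaloisRep.cyclotomicCharacter F ℓ σ : ℤ_[ℓ]ˣ) : ℤ_[ℓ]) : ℚ_[ℓ]) ^ k with hθ
  set g : ℤ_[ℓ] →+* E := (algebraMap ℚ_[ℓ] E).comp PadicInt.Coe.ringHom with hg
  have hgc : Continuous g := (continuous_algebraMap ℚ_[ℓ] E).comp continuous_subtype_val
  let ε₁ : absoluteGaloisGroup F →ₜ* Eˣ :=
    { toMonoidHom := (Units.map g.toMonoidHom).comp (GaloisRep.cyclotomicCharacter F ℓ).toMonoidHom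
      continuous_toFun := (Continuous.units_map _ hgc).comp
        (GaloisRep.cyclotomicCharacter F ℓ).continuous }
  let εE : absoluteGaloisGroup F →ₜ* Eˣ :=
    { toMonoidHom := (zpowGroupHom k).comp ε₁.toMonoidHom
      continuous_toFun := (continuous_zpow k).comp ε₁.continuous }
  have hεE : ∀ σ, (εE σ : E) = algebraMap ℚ_[ℓ] E (θ σ) := fun σ => by
    change (((ε₁ σ) ^ k : Eˣ) : E) = _
    rw [Units.val_zpow_eq_zpow_val, hθ, map_zpow₀]
    rfl
  have hεε : ∀ σ, (ε σ : PadicAlgCl ℓ) = algebraMap E (PadicAlgCl ℓ) (εE σ) := fun σ => by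
    rw [hεE, ← IsScalarTower.algebraMap_apply, hε σ, hθ, map_zpow₀]
  refine ⟨E, hE, rE.twist εE, hmodel.twist εE ε hεε, ?_⟩
  -- admissibility of the twisted model: scalar twist with the period `u ^ k`
  refine 𝔇.𝔅.isAdmissible_of_twist_period (restrictScalarsQl E rE) (restrictScalarsQl E (rE.twist εE))
    θ (fun σ x => ?_) (Units.ne_zero (u ^ k)) hk hdR
  rw [restrictScalarsQl_twist_apply, hεE, algebraMap_smul]

/-- **… in particular for every datum with Fontaine's clauses** ((F2): the cyclotomic character is
de Rham of weight `-1`). [cite: FontaineAsterisque223III, Exp. III Prop. 1.5.2] -/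
theorem _root_.Literature.NumberTheory.PAdicHodge.IsFontaineDatum.isDeRhamFramed_tateTwist [CharZero F]
    {hℓ : ValuativeRel.valuation F ℓ < 1} {𝔇 : PstWeilDeligneData F ℓ}
    (h𝔇 : Literature.NumberTheory.PAdicHodge.IsFontaineDatum hℓ 𝔇) {n : ℕ}
    {ρ : FramedRep (absoluteGaloisGroup F) (PadicAlgCl ℓ) n} (hρ : 𝔇.IsDeRhamFramed ρ) (k : ℤ)
    (ε : absoluteGaloisGroup F →ₜ* (PadicAlgCl ℓ)ˣ)
    (hε : ∀ σ, (ε σ : PadicAlgCl ℓ) =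
      (algebraMap ℚ_[ℓ] (PadicAlgCl ℓ)
        ((GaloisRep.cyclotomicCharacter F ℓ σ : ℤ_[ℓ]ˣ) : ℤ_[ℓ])) ^ k) :
    𝔇.IsDeRhamFramed (ρ.twist ε) :=
  hρ.tateTwist h𝔇.isDeRhamFramed_cyclotomic k ε hε

/-- **Powers of the cyclotomic character are de Rham** for every datum for which `χ_ℓ` is:
`1 ⊗ ε = ε` as a rank-`n` scalar representation (the trivial representation is unramified, hence
de Rham for every datum). [cite: FontaineAsterisque223III, Exp. III Prop. 1.5.2] -/
theorem PstWeilDeligneData.isDeRhamFramed_one_twist {𝔇 : PstWeilDeligneData F ℓ}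
    (hcyc : 𝔇.IsDeRhamFramed (FramedGaloisRep.cyclotomicPadicAlgCl F ℓ)) {n : ℕ} (k : ℤ)
    (ε : absoluteGaloisGroup F →ₜ* (PadicAlgCl ℓ)ˣ)
    (hε : ∀ σ, (ε σ : PadicAlgCl ℓ) =
      (algebraMap ℚ_[ℓ] (PadicAlgCl ℓ)
        ((GaloisRep.cyclotomicCharacter F ℓ σ : ℤ_[ℓ]ˣ) : ℤ_[ℓ])) ^ k) :
    𝔇.IsDeRhamFramed ((1 : FramedRep (absoluteGaloisGroup F) (PadicAlgCl ℓ) n).twist ε) :=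
  (𝔇.isDeRhamFramed_of_isLocallyUnramified FramedRep.isLocallyUnramified_one).tateTwist hcyc k ε hε

/-- **Unramified twisted by a power of the cyclotomic character is de Rham** (every datum for which
`χ_ℓ` is de Rham) — the shape `ψ ⊗ χ_ℓ^k`, `ψ` unramified, of the `ℓ`-adic avatar at `v ∣ ℓ` of an
algebraic Hecke character `χ₀‖·‖^{-k}` with `χ₀` unramified at `v`.
[cite: FontaineAsterisque223III, Exp. III Prop. 1.5.2] [cite: SerreAbelianLadic1968, Ch. I §1.2] -/
theorem PstWeilDeligneData.isDeRhamFramed_tateTwist_of_isLocallyUnramified {𝔇 : PstWeilDeligneData F ℓ}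
    (hcyc : 𝔇.IsDeRhamFramed (FramedGaloisRep.cyclotomicPadicAlgCl F ℓ)) {n : ℕ}
    {ρ : FramedRep (absoluteGaloisGroup F) (PadicAlgCl ℓ) n} (hρ : ρ.IsLocallyUnramified) (k : ℤ)
    (ε : absoluteGaloisGroup F →ₜ* (PadicAlgCl ℓ)ˣ)
    (hε : ∀ σ, (ε σ : PadicAlgCl ℓ) =
      (algebraMap ℚ_[ℓ] (PadicAlgCl ℓ)
        ((GaloisRep.cyclotomicCharacter F ℓ σ : ℤ_[ℓ]ˣ) : ℤ_[ℓ])) ^ k) :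
    𝔇.IsDeRhamFramed (ρ.twist ε) :=
  (𝔇.isDeRhamFramed_of_isLocallyUnramified hρ).tateTwist hcyc k ε hε

end Local

/-! ### 4. The summit's pinned datum at `v ∣ ℓ` -/

section NumberField

open IsDedekindDomain Literature.NumberTheory.PAdicHodge
open scoped NumberField

variable {K : Type} [Field K] [NumberField K] {ℓ : ℕ} [Fact ℓ.Prime] {n : ℕ}

/-- **Tate twists preserve "de Rham above `ℓ`" for the PINNED datum of the summit** (under the T0
named fact `FontaineDatumExists`): at a place `v ∣ ℓ`, if `ρ : Γ_{K_v} →ₜ* GL_n(ℚ̄_ℓ)` is de Rham for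
`fontainePstAdicCompletion v ℓ hv` then so is `ρ ⊗ ε` for every `ε = χ_ℓ^k` (`χ_ℓ` the cyclotomic
character of `K_v`). [cite: FontaineAsterisque223III, Exp. III Prop. 1.5.2] -/
theorem fontainePstAdicCompletion_isDeRhamFramed_tateTwist (hF : FontaineDatumExists)
    (v : HeightOneSpectrum (𝓞 K)) (hv : ((ℓ : ℕ) : 𝓞 K) ∈ v.asIdeal)
    {ρ : FramedRep (absoluteGaloisGroup (v.adicCompletion K)) (PadicAlgCl ℓ) n}
    (hρ : (fontainePstAdicCompletion v ℓ hv).IsDeRhamFramed ρ) (k : ℤ)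
    (ε : absoluteGaloisGroup (v.adicCompletion K) →ₜ* (PadicAlgCl ℓ)ˣ)
    (hε : ∀ σ, (ε σ : PadicAlgCl ℓ) =
      (algebraMap ℚ_[ℓ] (PadicAlgCl ℓ)
        ((GaloisRep.cyclotomicCharacter (v.adicCompletion K) ℓ σ : ℤ_[ℓ]ˣ) : ℤ_[ℓ])) ^ k) :
    (fontainePstAdicCompletion v ℓ hv).IsDeRhamFramed (ρ.twist ε) := by
  haveI := LocalField.charZero_adicCompletion v
  exact (isFontaineDatum_fontainePstAdicCompletion hF v ℓ hv).isDeRhamFramed_tateTwist hρ k ε hε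

/-- **… so at `v ∣ ℓ` an unramified representation twisted by `χ_ℓ^k` is de Rham for the pinned
datum** (under `FontaineDatumExists`). [cite: FontaineAsterisque223III, Exp. III Prop. 1.5.2] -/
theorem fontainePstAdicCompletion_isDeRhamFramed_tateTwist_of_isLocallyUnramified
    (hF : FontaineDatumExists) (v : HeightOneSpectrum (𝓞 K)) (hv : ((ℓ : ℕ) : 𝓞 K) ∈ v.asIdeal)
    {ρ : FramedRep (absoluteGaloisGroup (v.adicCompletion K)) (PadicAlgCl ℓ) n}
    (hρ : ρ.IsLocallyUnramified) (k : ℤ)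
    (ε : absoluteGaloisGroup (v.adicCompletion K) →ₜ* (PadicAlgCl ℓ)ˣ)
    (hε : ∀ σ, (ε σ : PadicAlgCl ℓ) =
      (algebraMap ℚ_[ℓ] (PadicAlgCl ℓ)
        ((GaloisRep.cyclotomicCharacter (v.adicCompletion K) ℓ σ : ℤ_[ℓ]ˣ) : ℤ_[ℓ])) ^ k) :
    (fontainePstAdicCompletion v ℓ hv).IsDeRhamFramed (ρ.twist ε) :=
  fontainePstAdicCompletion_isDeRhamFramed_tateTwist hF v hv
    ((fontainePstAdicCompletion v ℓ hv).isDeRhamFramed_of_isLocallyUnramified hρ) k ε hε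

end NumberField

end Literature.NumberTheory.GaloisRepresentations

end
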